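import Summits.CriticalPhenomena.PercolationContinuityZ3.Theorems.PercNearOneGluingNoHeavyLowerTailOutsiderPortStep
import Literature.Probability.Percolation.LonelyClusterExchange
import HarnessLib

/-!
# `NoHeavyLowerTail` (stmt-CriticalPhenomena-4575) — the DOMINATED-PORT STEP of the two-sided kernel: deleting the star edge of
# a port that is no lighter than `q` can only help the witness `q`

Support file (prover `prim-hp-3`, hull-port line, submodularity / Rayleigh-monotonicity seat; `--supports stmt-CriticalPhenomena-4575`).
No definitions, no named facts, no sorries.

Notation: `μ_w = prodBernoulli w` on `Fin n`, relays `A`, level `j`, `π(v) = {z ∈ A : v ↔ z}`, lightness `I_w(v) = μ_w{|π(v)| ≤ j}`;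
`O` a finite set of observers, `π(O) = {z ∈ A : ∃ x ∈ O, x ↔ z}`, and the E-MASS of a vertex `c`
  `E_w(c) := μ_w(c ↮ O, 1 ≤ |π(O)| ≤ j) + μ_w(c ↔ O, |π(c)| ≤ j)`
(file `…OutsiderPortStep.lean`).  `E_w(c) ≤ I_w(c)` is the champion-stability inequality `CS_w(O, c)` (`HullPort.obsE_le_of_setCS`,
`setCS_of_obsE_le`); for the two-pendant-stars kernel of the crux it is the TPS inequality with witness `c`.

**Theorem (`HullPort.obsE_glued_le_of_dominated`, the free glued endpoint).**  Let `o ∈ O`, `a ≠ o`, `q ≠ a` with `I_w(a) ≤ I_w(q)`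
(`q` dominates the port `a`).  Then in the weight function `w₁ = w[s(a,o) ↦ 1]` (the port glued to its observer) `E_{w₁}(q) ≤ I_{w₁}(q)`.
Proof: raising the own pair of the loser `a` keeps `I(a) ≤ I(q)` (`lightness_le_of_raise_own_edge`, van den Berg–Häggström–Kahn Thm 1.5);
under `w₁` the observer `o` is a.s. glued to `a`, so `I_{w₁}(o) = I_{w₁}(a) ≤ I_{w₁}(q)` (`lightness_eq_of_weight_one`); a member of `O` no
lighter than `q` gives `CS_{w₁}(O,q)` (`observerSet_le_of_lonelier`), i.e. `E_{w₁}(q) ≤ I_{w₁}(q)`.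

**Corollary (`HullPort.obsE_le_of_dominated_port_erase`, the dominated-port step).**  With `w₀ = w[s(a,o) ↦ 0]`: if `I_w(a) ≤ I_w(q)` and
`E_{w₀}(q) ≤ I_{w₀}(q)` then `E_w(q) ≤ I_w(q)` — `q` is a common witness for itself at both endpoints of the coordinate `s(a,o)`
(`obsE_le_of_common_witness`).  Equivalently, writing `g_q(w) := I_w(q) − E_w(q)` (affine in every coordinate):
`g_q(w) ≥ (1 − w s(a,o))·g_q(w₀)` whenever `q` dominates `a` — deleting the star edge of a dominated port costs the witness `q` at most a
positive factor.

WHY (crux notes `run/shared/lean/prim/prim-hp-3/HULLPORT-REF-gen6.md` §1–§3).  In the two-pendant-stars kernel (`O = {o₁,o₂}`, `q` a relay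
dominating every port in `H`) EVERY star edge satisfies the hypothesis, so TPS-domination for `H` follows from the validity of `q` in ONE of the
deleted instances `H − e`; iterating gives the exact stripping identity `g_q(H) = Σ_l μ(F_l)·[I_{G(J_l/e_l)}(q) − I_{G(J_l/e_l)}(a_l)] + μ(all closed)·I_K(q)`
and reduces TPS-domination, by induction on the number of star edges, to the one-step statement GOOD-EDGE (some deletion `H − e` in which `q`
still dominates the ports, or is merged-lighter than the lightest port; exact census 0 failures / 1 414 dominating pairs incl. the 85 pairs outside
the criteria C1..C6 of ttrl `halflin/JOINTCOV.md`).  The transfer form of the step (validity of another vertex `y` one edge down plus a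
merged-lightness comparison) is `HullPort.obsE_le_of_dominated_port_erase_transfer` in the companion file `…DominatedPortTransfer.lean`.
-/

noncomputable section

namespace Summit.CriticalPhenomena.PercolationContinuityZ3.Theorems

open MeasureTheory Set Literature.Probability.LatticeModels Literature.Probability.Percolation
open scoped Classical BigOperators

variable {n : ℕ}

namespace HullPort

/-- **The free glued endpoint.**  `o ∈ O`, `a ≠ o`, `q ≠ a`, `I_w(a) ≤ I_w(q)`.  Then with the pair `s(a,o)` raised to weight one,
`E_{w[s(a,o)↦1]}(q) ≤ I_{w[s(a,o)↦1]}(q)`.  (Raise the own pair of the loser; the glued observer is as light as its port; a member of `O`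
no lighter than `q` yields champion stability.) [cite: VandenbergHaggstromKahn2005, Thm. 1.5 (p. 7) — via `lightness_le_of_raise_own_edge`
and `observerSet_le_of_lonelier`; this work] -/
theorem obsE_glued_le_of_dominated (w : Sym2 (Fin n) → unitInterval) (A O : Finset (Fin n)) (o a q : Fin n) (j : ℕ)
    (ho : o ∈ O) (hao : a ≠ o) (hqa : q ≠ a)
    (hdom : (prodBernoulli w).real {ω : BondConfig (Fin n) | (A.filter fun z => ω ∈ openConn a z).card ≤ j} ≤
      (prodBernoulli w).real {ω : BondConfig (Fin n) | (A.filter fun z => ω ∈ openConn q z).card ≤ j}) :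
    (prodBernoulli (Function.update w s(a, o) 1)).real {ω : BondConfig (Fin n) | (∀ x ∈ O, ω ∉ openConn q x) ∧
        1 ≤ (A.filter fun z => ∃ x ∈ O, ω ∈ openConn x z).card ∧
        (A.filter fun z => ∃ x ∈ O, ω ∈ openConn x z).card ≤ j} +
      (prodBernoulli (Function.update w s(a, o) 1)).real {ω : BondConfig (Fin n) | (∃ x ∈ O, ω ∈ openConn q x) ∧
        (A.filter fun z => ω ∈ openConn q z).card ≤ j} ≤
      (prodBernoulli (Function.update w s(a, o) 1)).real
        {ω : BondConfig (Fin n) | (A.filter fun z => ω ∈ openConn q z).card ≤ j} := by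
  set w₁ := Function.update w s(a, o) 1 with hw₁
  -- raising the own pair of `a` keeps `I(a) ≤ I(q)`
  have hwe : Function.update w s(a, o) (w s(a, o)) = w := Function.update_eq_self _ w
  have h1 : (prodBernoulli w₁).real {ω : BondConfig (Fin n) | (A.filter fun z => ω ∈ openConn a z).card ≤ j} ≤
      (prodBernoulli w₁).real {ω : BondConfig (Fin n) | (A.filter fun z => ω ∈ openConn q z).card ≤ j} := by
    have h := lightness_le_of_raise_own_edge w A a o q j hao hqa (w s(a, o)) 1 (w s(a, o)).2.2 (by rw [hwe]; exact hdom)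
    exact h
  -- the glued observer is as light as its port
  have hoa : o ≠ a := fun h => hao h.symm
  have hw₁e : w₁ s(o, a) = 1 := by
    rw [Sym2.eq_swap]; simp [hw₁]
  have h2 := lightness_eq_of_weight_one w₁ A hoa j hw₁e
  have h3 : (prodBernoulli w₁).real {ω : BondConfig (Fin n) | (A.filter fun z => ω ∈ openConn o z).card ≤ j} ≤
      (prodBernoulli w₁).real {ω : BondConfig (Fin n) | (A.filter fun z => ω ∈ openConn q z).card ≤ j} := by
    rw [h2]; exact h1
  -- a member of `O` no lighter than `q` gives champion stability, i.e. the E-mass bound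
  have h4 := observerSet_le_of_lonelier w₁ A O o q ho j h3
  refine obsE_le_of_setCS w₁ A O q j ?_
  convert h4 using 12

/-- **The dominated-port step.**  `o ∈ O`, `a ≠ o`, `q ≠ a`, `I_w(a) ≤ I_w(q)`.  If `E_{w[s(a,o)↦0]}(q) ≤ I_{w[s(a,o)↦0]}(q)` (the
witness `q` is valid with the star edge `s(a,o)` deleted) then `E_w(q) ≤ I_w(q)`.  (The glued endpoint is free by
`obsE_glued_le_of_dominated`; affinity in the coordinate, `obsE_le_of_common_witness`.)  WHY: in the two-pendant-stars kernel every star edge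
of an instance in which `q` dominates all ports satisfies the hypothesis, so validity of `q` one edge down (for ANY edge) lifts to `H`.
[cite: VandenbergHaggstromKahn2005, Thm. 1.5 (p. 7) — via `obsE_glued_le_of_dominated`; this work] -/
theorem obsE_le_of_dominated_port_erase (w : Sym2 (Fin n) → unitInterval) (A O : Finset (Fin n)) (o a q : Fin n) (j : ℕ)
    (ho : o ∈ O) (hao : a ≠ o) (hqa : q ≠ a)
    (hdom : (prodBernoulli w).real {ω : BondConfig (Fin n) | (A.filter fun z => ω ∈ openConn a z).card ≤ j} ≤
      (prodBernoulli w).real {ω : BondConfig (Fin n) | (A.filter fun z => ω ∈ openConn q z).card ≤ j})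
    (h0 : (prodBernoulli (Function.update w s(a, o) 0)).real {ω : BondConfig (Fin n) | (∀ x ∈ O, ω ∉ openConn q x) ∧
          1 ≤ (A.filter fun z => ∃ x ∈ O, ω ∈ openConn x z).card ∧
          (A.filter fun z => ∃ x ∈ O, ω ∈ openConn x z).card ≤ j} +
        (prodBernoulli (Function.update w s(a, o) 0)).real {ω : BondConfig (Fin n) | (∃ x ∈ O, ω ∈ openConn q x) ∧
          (A.filter fun z => ω ∈ openConn q z).card ≤ j} ≤
        (prodBernoulli (Function.update w s(a, o) 0)).real
          {ω : BondConfig (Fin n) | (A.filter fun z => ω ∈ openConn q z).card ≤ j}) :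
    (prodBernoulli w).real {ω : BondConfig (Fin n) | (∀ x ∈ O, ω ∉ openConn q x) ∧
        1 ≤ (A.filter fun z => ∃ x ∈ O, ω ∈ openConn x z).card ∧
        (A.filter fun z => ∃ x ∈ O, ω ∈ openConn x z).card ≤ j} +
      (prodBernoulli w).real {ω : BondConfig (Fin n) | (∃ x ∈ O, ω ∈ openConn q x) ∧
        (A.filter fun z => ω ∈ openConn q z).card ≤ j} ≤
      (prodBernoulli w).real {ω : BondConfig (Fin n) | (A.filter fun z => ω ∈ openConn q z).card ≤ j} :=
  obsE_le_of_common_witness w A O s(a, o) q q j h0 (obsE_glued_le_of_dominated w A O o a q j ho hao hqa hdom)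

/-- **Sure port.**  If the pair `s(a,o)` already has weight one (`o ∈ O`, `a ≠ o`, `q ≠ a`) and `I_w(a) ≤ I_w(q)`, then `E_w(q) ≤ I_w(q)`
outright. [cite: VandenbergHaggstromKahn2005, Thm. 1.5 (p. 7) — via `obsE_glued_le_of_dominated`; this work] -/
theorem obsE_le_of_dominated_sure_port (w : Sym2 (Fin n) → unitInterval) (A O : Finset (Fin n)) (o a q : Fin n) (j : ℕ)
    (ho : o ∈ O) (hao : a ≠ o) (hqa : q ≠ a) (hw : w s(a, o) = 1)
    (hdom : (prodBernoulli w).real {ω : BondConfig (Fin n) | (A.filter fun z => ω ∈ openConn a z).card ≤ j} ≤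
      (prodBernoulli w).real {ω : BondConfig (Fin n) | (A.filter fun z => ω ∈ openConn q z).card ≤ j}) :
    (prodBernoulli w).real {ω : BondConfig (Fin n) | (∀ x ∈ O, ω ∉ openConn q x) ∧
        1 ≤ (A.filter fun z => ∃ x ∈ O, ω ∈ openConn x z).card ∧
        (A.filter fun z => ∃ x ∈ O, ω ∈ openConn x z).card ≤ j} +
      (prodBernoulli w).real {ω : BondConfig (Fin n) | (∃ x ∈ O, ω ∈ openConn q x) ∧
        (A.filter fun z => ω ∈ openConn q z).card ≤ j} ≤
      (prodBernoulli w).real {ω : BondConfig (Fin n) | (A.filter fun z => ω ∈ openConn q z).card ≤ j} := by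
  have hw1 : Function.update w s(a, o) 1 = w := by
    rw [Function.update_eq_self_iff]; exact hw.symm
  have h := obsE_glued_le_of_dominated w A O o a q j ho hao hqa hdom
  rw [hw1] at h
  exact h

end HullPort

end Summit.CriticalPhenomena.PercolationContinuityZ3.Theorems

end
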